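import Mathlib
import HarnessLib
import Summits.ABC.ABC.Theses.ParitySliceConcordantNorms
import Literature.NumberTheory.DiophantineGeometry.AbcWave0BakerExplicitProofs
import Literature.Barriers.ABC.ExplicitABCQualityFloor
import Literature.Barriers.ABC.MasonStothersFailsInCharP
import Literature.Barriers.ABC.NoArithmeticDerivative

/-!
# Strategy census (Lean side) for the crux `NonSquareTopABC` (stmt-ABC-4010)

Companion to `STRATEGY-CENSUS.md` (crux-strategist seat `planner-cstrat-stmt-ABC-4010-s1-0`,
2026-08-17).  Everything here is sorry-free and `lean check`ed; it TYPES the attempts recorded in the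
census so that the verdict "no strategy short of the summit" rests on checked objects, not prose:

* `## Decomposition` — D3, the best ALTERNATIVE typed split found (re-cut by the square class `c₀` of
  the top alone, `TopClassABC ∧ LargeTopClassUniform`), with the composition to the crux AND the
  converse both proved (`nonSquareTopABC_of_topClass`, `topClass_of_crux`, `crux_iff_topClass`); D4,
  the archimedean `θ`-cut (`NearSquareTopABC θ ∧ FarSquareTopABC θ`) with its composition; and the
  `ring` check of the degree-4 Belyi identity `64a³b + (b²+6ab−3a²)² = c³(9a+b)` (the unique dessin
  of passport (3,1)(3,1)(2,2)) used in the census to argue that no identity of degree ≤ 4 steers a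
  triple into a FIXED non-square top class.
* `## Strengthen` — S1: Baker's explicit conjecture (tree decl `BakerExplicitABC`, abc.S04) gives the
  crux outright through the LANDED `BakerExplicitABC.forall_exists_const`
  (anonymous `example : BakerExplicitABC → NonSquareTopABC`): it feeds `closes`, and by the same
  token it is summit-or-stronger (costume as a stub); Reyssat's floor triple has non-square top.
* `## Negation` — N1: the first member of the best counterexample family with NON-square top,
  `1 + (2²¹ − 1) = 2²¹` (`2²¹ − 1 = 7²·127·337`, `rad = 599186 < c`, quality `> 1.094`,
  `¬ IsSquare 2²¹`), kernel-checked; the family's quality tends to `1`.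
* `## Transfer` — T1: the exact sibling of THIS crux in `k[X]`, char `2`: "top not a Frobenius
  square ⟹ Mason–Stothers" is a one-line corollary of the tree's
  `Literature.Barriers.ABC.masonStothers_charP_of_not_frobenius`; the transferring step dies on `ℤ`
  by `Literature.Barriers.ABC.IntegersHaveNoDerivation` (restated here as the `example` closing the
  file).
-/

set_option linter.dupNamespace false

namespace Summit.ABC.ABC.Cruxes.NonSquareTopABC.StrategyCensus

open Literature.NumberTheory.DiophantineGeometry
open Summit.ABC.ABC.Theses.ParitySliceConcordantNorms

/-! ## Shared glue -/

/-- `c₀ z²` with `c₀ > 1` squarefree and `z ≠ 0` is not a perfect square. [folklore] -/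
theorem not_isSquare_mul_sq {c₀ z : ℕ} (hsf : Squarefree c₀) (hc₀ : 1 < c₀) (hz : z ≠ 0) :
    ¬ IsSquare (c₀ * z ^ 2) := by
  rintro ⟨r, hr⟩
  have hc0 : c₀ ≠ 0 := by omega
  obtain ⟨p, hp, hpc⟩ := Nat.exists_prime_and_dvd hc₀.ne'
  have hr0 : r ≠ 0 := by
    rintro rfl
    simp at hr
    omega
  have h1 : c₀.factorization p = 1 := by
    have hle := (Nat.squarefree_iff_factorization_le_one hc0).mp hsf p
    have hpos := hp.factorization_pos_of_dvd hc0 hpc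
    omega
  have key := congrArg (fun n => n.factorization p) hr
  simp only [Nat.factorization_mul hc0 (pow_ne_zero 2 hz), Nat.factorization_pow,
    Nat.factorization_mul hr0 hr0, Finsupp.add_apply, Finsupp.smul_apply, smul_eq_mul] at key
  omega

/-- In an abc triple `(a, b, c₀ z²)` the parameter `z` is non-zero. [folklore] -/
theorem z_ne_zero_of_triple {a b c₀ z : ℕ} (ht : IsABCTriple a b (c₀ * z ^ 2)) : z ≠ 0 := by
  rintro rfl
  obtain ⟨ha, -, habc, -⟩ := ht
  rw [show c₀ * 0 ^ 2 = 0 by ring] at habc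
  omega

/-- Every abc triple with non-square top has `c = c₀ z²` with `c₀ > 1` squarefree. [folklore] -/
theorem topClass_of_triple (a b c : ℕ) (ht : IsABCTriple a b c) (hns : ¬ IsSquare c) :
    ∃ c₀ z : ℕ, Squarefree c₀ ∧ 1 < c₀ ∧ c = c₀ * z ^ 2 := by
  obtain ⟨ha, hb, habc, -⟩ := ht
  have hc : 0 < c := by omega
  obtain ⟨c₀, z, hc₀, hz, hzc, hsc⟩ := Nat.sq_mul_squarefree_of_pos hc
  have hc₀1 : c₀ ≠ 1 := by
    rintro rfl
    exact hns ⟨z, by rw [← hzc]; ring⟩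
  exact ⟨c₀, z, hsc, by omega, by rw [← hzc, mul_comm]⟩

/-! ## Decomposition D3 — re-cut by the square class of the top alone -/

/-- **T₁ (fixed top class).** abc for the triples whose top is `c₀ z²`, for each FIXED squarefree
`c₀ > 1`, with a constant `C(c₀, ε)` uniform in the legs `a, b` and in `z`. Strictly between the
route's `GenericSliceLangevin` (constant per slice `(a₀,b₀,c₀)`) and the crux (constant per `ε`). -/
def TopClassABC : Prop :=
  ∀ c₀ : ℕ, Squarefree c₀ → 1 < c₀ → ∀ ε : ℝ, 0 < ε → ∃ C : ℝ, 0 < C ∧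
    ∀ a b z : ℕ, IsABCTriple a b (c₀ * z ^ 2) →
      ((c₀ * z ^ 2 : ℕ) : ℝ) < C * ((rad a b (c₀ * z ^ 2) : ℕ) : ℝ) ^ (1 + ε)

/-- **T₂ (large top class, uniform).** For every `ε > 0` a threshold `N` and ONE constant `C` serving
every top class `c₀ > N`. -/
def LargeTopClassUniform : Prop :=
  ∀ ε : ℝ, 0 < ε → ∃ N : ℕ, ∃ C : ℝ, 0 < C ∧
    ∀ c₀ a b z : ℕ, Squarefree c₀ → N < c₀ → IsABCTriple a b (c₀ * z ^ 2) →
      ((c₀ * z ^ 2 : ℕ) : ℝ) < C * ((rad a b (c₀ * z ^ 2) : ℕ) : ℝ) ^ (1 + ε)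

/-- **D3 composition (sorry-free).** `T₁ → T₂ → NonSquareTopABC`: classes `c₀ ≤ N(ε)` are finitely
many, paid by the sum of their `T₁`-constants; classes `c₀ > N(ε)` by `T₂`. [folklore] -/
theorem nonSquareTopABC_of_topClass (h₁ : TopClassABC) (h₂ : LargeTopClassUniform) :
    NonSquareTopABC := by
  intro ε hε
  obtain ⟨N, C₂, hC₂, H₂⟩ := h₂ ε hε
  have htab : ∀ c₀ : ℕ, ∃ C : ℝ, 0 < C ∧ (Squarefree c₀ → 1 < c₀ →
      ∀ a b z : ℕ, IsABCTriple a b (c₀ * z ^ 2) →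
        ((c₀ * z ^ 2 : ℕ) : ℝ) < C * ((rad a b (c₀ * z ^ 2) : ℕ) : ℝ) ^ (1 + ε)) := by
    intro c₀
    by_cases h : Squarefree c₀ ∧ 1 < c₀
    · obtain ⟨C, hC, H⟩ := h₁ c₀ h.1 h.2 ε hε
      exact ⟨C, hC, fun _ _ => H⟩
    · exact ⟨1, one_pos, fun hs hc => absurd ⟨hs, hc⟩ h⟩
  choose Cf hCfpos hCf using htab
  set C₁ : ℝ := ∑ c₀ ∈ Finset.range (N + 1), Cf c₀ with hC₁
  have hC₁ : 0 ≤ C₁ := Finset.sum_nonneg fun c₀ _ => (hCfpos c₀).le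
  refine ⟨C₁ + C₂, by linarith, ?_⟩
  intro a b c ht hns
  obtain ⟨c₀, z, hsf, hc₀, rfl⟩ := topClass_of_triple a b c ht hns
  have hR : (0 : ℝ) ≤ ((rad a b (c₀ * z ^ 2) : ℕ) : ℝ) ^ (1 + ε) :=
    Real.rpow_nonneg (Nat.cast_nonneg _) _
  by_cases hN : N < c₀
  · calc ((c₀ * z ^ 2 : ℕ) : ℝ)
        < C₂ * ((rad a b (c₀ * z ^ 2) : ℕ) : ℝ) ^ (1 + ε) := H₂ c₀ a b z hsf hN ht
      _ ≤ (C₁ + C₂) * ((rad a b (c₀ * z ^ 2) : ℕ) : ℝ) ^ (1 + ε) :=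
          mul_le_mul_of_nonneg_right (by linarith) hR
  · push Not at hN
    have hmem : c₀ ∈ Finset.range (N + 1) := Finset.mem_range.mpr (by omega)
    have hle : Cf c₀ ≤ C₁ :=
      Finset.single_le_sum (f := fun c₀ => Cf c₀) (fun c₀ _ => (hCfpos c₀).le) hmem
    calc ((c₀ * z ^ 2 : ℕ) : ℝ)
        < Cf c₀ * ((rad a b (c₀ * z ^ 2) : ℕ) : ℝ) ^ (1 + ε) := hCf c₀ hsf hc₀ a b z ht
      _ ≤ (C₁ + C₂) * ((rad a b (c₀ * z ^ 2) : ℕ) : ℝ) ^ (1 + ε) :=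
          mul_le_mul_of_nonneg_right (by linarith) hR

/-- **D3 exactness.** Both pieces follow from the crux by restriction. [folklore] -/
theorem topClass_of_crux (h : NonSquareTopABC) : TopClassABC ∧ LargeTopClassUniform := by
  refine ⟨fun c₀ hsf hc₀ ε hε => ?_, fun ε hε => ?_⟩
  · obtain ⟨C, hC, H⟩ := h ε hε
    exact ⟨C, hC, fun a b z ht =>
      H a b _ ht (not_isSquare_mul_sq hsf hc₀ (z_ne_zero_of_triple ht))⟩
  · obtain ⟨C, hC, H⟩ := h ε hε
    refine ⟨1, C, hC, fun c₀ a b z hsf hN ht => ?_⟩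
    exact H a b _ ht (not_isSquare_mul_sq hsf (by omega) (z_ne_zero_of_triple ht))

/-- **D3 is an exact split** of the crux. [folklore] -/
theorem crux_iff_topClass : NonSquareTopABC ↔ (TopClassABC ∧ LargeTopClassUniform) :=
  ⟨topClass_of_crux, fun h => nonSquareTopABC_of_topClass h.1 h.2⟩

/-! ## Decomposition D4 — the archimedean `θ`-cut -/

/-- **A_θ (near-square tops):** abc for non-square tops whose squarefree part is `< c^θ`. -/
def NearSquareTopABC (θ : ℝ) : Prop :=
  ∀ ε : ℝ, 0 < ε → ∃ C : ℝ, 0 < C ∧ ∀ a b c₀ z : ℕ, Squarefree c₀ → 1 < c₀ →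
    IsABCTriple a b (c₀ * z ^ 2) → (c₀ : ℝ) < ((c₀ * z ^ 2 : ℕ) : ℝ) ^ θ →
      ((c₀ * z ^ 2 : ℕ) : ℝ) < C * ((rad a b (c₀ * z ^ 2) : ℕ) : ℝ) ^ (1 + ε)

/-- **B_θ (far-from-square tops):** abc for tops whose squarefree part is `≥ c^θ`. Trivial as soon as
`(1 + ε) θ ≥ 1` (then `rad ≥ c₀ ≥ c^θ` already); open below that. -/
def FarSquareTopABC (θ : ℝ) : Prop :=
  ∀ ε : ℝ, 0 < ε → ∃ C : ℝ, 0 < C ∧ ∀ a b c₀ z : ℕ, Squarefree c₀ → 1 < c₀ →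
    IsABCTriple a b (c₀ * z ^ 2) → ((c₀ * z ^ 2 : ℕ) : ℝ) ^ θ ≤ (c₀ : ℝ) →
      ((c₀ * z ^ 2 : ℕ) : ℝ) < C * ((rad a b (c₀ * z ^ 2) : ℕ) : ℝ) ^ (1 + ε)

/-- **D4 composition (sorry-free).** [folklore] -/
theorem nonSquareTopABC_of_thetaCut (θ : ℝ) (hA : NearSquareTopABC θ) (hB : FarSquareTopABC θ) :
    NonSquareTopABC := by
  intro ε hε
  obtain ⟨C₁, hC₁, H₁⟩ := hA ε hε
  obtain ⟨C₂, hC₂, H₂⟩ := hB ε hε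
  refine ⟨max C₁ C₂, lt_max_of_lt_left hC₁, ?_⟩
  intro a b c ht hns
  obtain ⟨c₀, z, hsf, hc₀, rfl⟩ := topClass_of_triple a b c ht hns
  have hR : (0 : ℝ) ≤ ((rad a b (c₀ * z ^ 2) : ℕ) : ℝ) ^ (1 + ε) :=
    Real.rpow_nonneg (Nat.cast_nonneg _) _
  rcases lt_or_ge (c₀ : ℝ) (((c₀ * z ^ 2 : ℕ) : ℝ) ^ θ) with hlt | hge
  · exact (H₁ a b c₀ z hsf hc₀ ht hlt).trans_le
      (mul_le_mul_of_nonneg_right (le_max_left _ _) hR)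
  · exact (H₂ a b c₀ z hsf hc₀ ht hge).trans_le
      (mul_le_mul_of_nonneg_right (le_max_right _ _) hR)

/-- The degree-4 Belyi identity of passport `(3,1)(3,1)(2,2)` (unique dessin, monodromy `A₄`):
`64a³b + (b² + 6ab − 3a²)² = c³(9a + b)` with `c = a + b`. Its all-even fibre is an honest SQUARE
(coefficient `1`), so it breeds square LEGS, never a fixed non-square top class (census, D3).
[folklore] -/
example (a b : ℤ) :
    64 * a ^ 3 * b + (b ^ 2 + 6 * a * b - 3 * a ^ 2) ^ 2 = (a + b) ^ 3 * (9 * a + b) := by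
  ring

/-- The route's three quality-transferring identities, for comparison (all-even fibres absent).
[cite: deWeger2023Fudge, §3.6] -/
example (a b : ℤ) : (a + b) * (2 * b - a) ^ 2 + a ^ 2 * (3 * b - a) = 4 * b ^ 3 := by ring

/-! ## Strengthen S1 — Baker's explicit conjecture gives the crux outright -/

/-- `BakerExplicitABC → NonSquareTopABC`, through the LANDED `BakerExplicitABC.forall_exists_const`
and restriction to non-square tops: the explicit form feeds `closes`, and is summit-or-stronger.
[cite: Baker2004, §3 Conjecture 4] -/
example : BakerExplicitABC → NonSquareTopABC := by
  intro h ε hε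
  obtain ⟨C, hC, H⟩ := h.forall_exists_const ε hε
  exact ⟨C, hC, fun a b c ht _ => H a b c ht⟩

/-- Conversely the explicit form is NOT implied by the crux or by `ABC` as typed (it pins `C(ε)`);
what the tree knows is only its floor: the constant `6/5` cannot be lowered to `1.1997`
(`Literature.Barriers.ABC.BakerShapeConstantFloor`, at Reyssat's triple — whose top `23⁵` is a
NON-square, so the floor sits inside this crux's scope). [cite: Baker2004, §4 (p. 258)] -/
example : ¬ IsSquare (23 ^ 5 : ℕ) := by
  have h : (23 ^ 5 : ℕ) = 23 * (23 ^ 2) ^ 2 := by norm_num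
  rw [h]
  exact not_isSquare_mul_sq (Nat.prime_iff.mp (by norm_num : Nat.Prime 23)).squarefree
    (by norm_num) (by norm_num)

/-! ## Negation N1 — the first member of the best non-square-top family, kernel-checked -/

/-- `1 + (2²¹ − 1) = 2²¹` is an abc triple. [folklore] -/
theorem mersenne21_isABCTriple : IsABCTriple 1 (2 ^ 21 - 1) (2 ^ 21) := by
  refine ⟨by norm_num, by norm_num, by norm_num, ?_⟩
  norm_num

/-- `2²¹ − 1 = 7² · 127 · 337` (`ord₄₉ 2 = 21`). [folklore] -/
theorem mersenne21_eq : 2 ^ 21 - 1 = 7 ^ 2 * 127 * 337 := by norm_num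

/-- `rad(1 · (2²¹ − 1) · 2²¹) = 2 · 7 · 127 · 337 = 599186`. [folklore] -/
theorem rad_mersenne21 : rad 1 (2 ^ 21 - 1) (2 ^ 21) = 599186 := by
  rw [rad_def, mersenne21_eq, one_mul]
  have h1 : IsRelPrime (7 ^ 2 * 127 * 337 : ℕ) (2 ^ 21) := by
    rw [← Nat.coprime_iff_isRelPrime]; norm_num
  have h2 : IsRelPrime (7 ^ 2 * 127 : ℕ) 337 := by
    rw [← Nat.coprime_iff_isRelPrime]; norm_num
  have h3 : IsRelPrime (7 ^ 2 : ℕ) 127 := by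
    rw [← Nat.coprime_iff_isRelPrime]; norm_num
  rw [UniqueFactorizationMonoid.radical_mul h1, UniqueFactorizationMonoid.radical_mul h2,
    UniqueFactorizationMonoid.radical_mul h3,
    UniqueFactorizationMonoid.radical_pow _ (by norm_num),
    UniqueFactorizationMonoid.radical_pow _ (by norm_num),
    Literature.Barriers.ABC.radical_natPrime (by norm_num),
    Literature.Barriers.ABC.radical_natPrime (by norm_num),
    Literature.Barriers.ABC.radical_natPrime (by norm_num),
    Literature.Barriers.ABC.radical_natPrime (by norm_num)]
  norm_num

/-- It is a HIT (`rad < c`). [folklore] -/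
theorem mersenne21_hit : rad 1 (2 ^ 21 - 1) (2 ^ 21) < 2 ^ 21 := by
  rw [rad_mersenne21]; norm_num

set_option exponentiation.threshold 5000 in
/-- Integer comparison behind "quality `> 1.094`": `599186¹⁰⁹⁴ < (2²¹)¹⁰⁰⁰`. [folklore] -/
theorem mersenne21_pow_lt : (599186 : ℕ) ^ 1094 < (2 ^ 21) ^ 1000 := by
  decide

/-- The triple has quality `> 1.094` (and the family `(1, 2ⁿ − 1, 2ⁿ)`, `n = 21k` odd, has quality
`→ 1`: not a counterexample to the crux). [folklore] -/
theorem mersenne21_quality_gt : (1.094 : ℝ) < quality 1 (2 ^ 21 - 1) (2 ^ 21) := by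
  rw [quality, rad_mersenne21]
  have hr : (0 : ℝ) < Real.log ((599186 : ℕ) : ℝ) := Real.log_pos (by norm_num)
  rw [lt_div_iff₀ hr]
  have h := Nat.cast_lt (α := ℝ).mpr mersenne21_pow_lt
  rw [Nat.cast_pow, Nat.cast_pow] at h
  have hlog := Real.log_lt_log (by positivity) h
  rw [Real.log_pow, Real.log_pow] at hlog
  push_cast at hlog ⊢
  linarith

/-- Its top `2²¹` is NOT a square (odd exponent), so it lies in the crux's scope. [folklore] -/
theorem not_isSquare_two_pow_21 : ¬ IsSquare (2 ^ 21 : ℕ) := by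
  have h : (2 ^ 21 : ℕ) = 2 * (2 ^ 10) ^ 2 := by norm_num
  rw [h]
  exact not_isSquare_mul_sq Nat.squarefree_two (by norm_num) (by norm_num)

/-- Packaging: a non-square-top abc hit of quality `> 1.094` exists (the negation side is not empty;
what is missing is `quality ≥ 1 + ε₀` along an infinite family). [folklore] -/
theorem exists_nonSquareTop_hit :
    ∃ a b c : ℕ, IsABCTriple a b c ∧ ¬ IsSquare c ∧ rad a b c < c ∧ (1.094 : ℝ) < quality a b c :=
  ⟨1, 2 ^ 21 - 1, 2 ^ 21, mersenne21_isABCTriple, not_isSquare_two_pow_21, mersenne21_hit,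
    mersenne21_quality_gt⟩

/-! ## Transfer T1 — the exact sibling in `k[X]`, characteristic 2 -/

section CharTwo

open Polynomial UniqueFactorizationMonoid

variable {k : Type*} [Field k] [DecidableEq k] [CharP k 2]

/-- **The crux's sibling in `k[X]`, `char k = 2`, is a theorem of the tree.** If `a + b = c` are
coprime non-zero polynomials and the top `c` is NOT a Frobenius square (`c ∉ k[X²]`), the
Mason–Stothers bound `deg c + 1 ≤ deg rad(abc)` holds — one line from
`Literature.Barriers.ABC.masonStothers_charP_of_not_frobenius`. The transferring step (differentiate
the relation; `c' ≠ 0` iff `c ∉ k[X²]`) has no analogue on `ℤ` (`IntegersHaveNoDerivation` below).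
[cite: EvertseGyory2015, §7.6 Thm. 7.6.1] -/
theorem masonStothers_charTwo_of_top_not_frobenius {a b c : k[X]} (ha : a ≠ 0) (hb : b ≠ 0)
    (hc : c ≠ 0) (hab : IsCoprime a b) (hsum : a + b = c)
    (hcF : c ∉ Set.range (expand k 2)) :
    natDegree c + 1 ≤ (radical (a * b * c)).natDegree := by
  haveI : Fact (Nat.Prime 2) := ⟨Nat.prime_two⟩
  have hsum' : a + b + (-c) = 0 := by rw [hsum]; ring
  have hF : ¬ (a ∈ Set.range (expand k 2) ∧ b ∈ Set.range (expand k 2) ∧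
      -c ∈ Set.range (expand k 2)) := by
    rintro ⟨-, -, ⟨g, hg⟩⟩
    exact hcF ⟨-g, by rw [map_neg, hg, neg_neg]⟩
  have h := (Literature.Barriers.ABC.masonStothers_charP_of_not_frobenius 2 ha hb
    (neg_ne_zero.mpr hc) hab hsum' hF).2.2
  have hrad : radical (a * b * -c) = radical (a * b * c) := by
    rw [show a * b * -c = -(a * b * c) by ring]
    exact (radical_eq_of_associated (Associated.neg_left (Associated.refl _)))
  rw [natDegree_neg, hrad] at h
  exact h

end CharTwo

/-- Where T1 breaks on `ℤ`: the only additive Leibniz map on `ℤ` is zero (tree theorem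
`Literature.Barriers.ABC.IntegersHaveNoDerivation`). [cite: GranvilleTucker2002, pp. 1224–1225] -/
example (M : Type*) [AddCommGroup M] [Module ℤ M] (D : Derivation ℤ ℤ M) : D = 0 :=
  Literature.Barriers.ABC.IntegersHaveNoDerivation M D

end Summit.ABC.ABC.Cruxes.NonSquareTopABC.StrategyCensus
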